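import Literature.NumberTheory.LFunctions.SelbergDelangeOmegaProofs
import Literature.NumberTheory.LFunctions.SelbergDelangeZetaPowLocal
import Literature.NumberTheory.LFunctions.ZetaPowCoeffShortInterval
import HarnessLib

/-!
# Montgomery–Vaughan Theorems 7.17 and 7.18 (the Selberg–Delange theorem): the discharges

Topic `Literature/NumberTheory/LFunctions`. Everything here is PROVED (theorems only; no
definitions of notions, no named facts). This file discharges the two named facts of
`SelbergDelangeTheorem.lean`:

* `MontgomeryVaughan2007_thm_7_17_holds : MontgomeryVaughan2007_thm_7_17` — the mean value of the
  coefficients `d_z(n)` of `ζ(s)^z`: for every `R > 0` there is `C` with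
  `|Σ_{n ≤ x} d_z(n) − Γ(z)⁻¹ x (log x)^{z−1}| ≤ C x (log x)^{Re z − 2}` (`x ≥ 2`, `|z| ≤ R`);
* `MontgomeryVaughan2007_thm_7_18_holds : MontgomeryVaughan2007_thm_7_18` — the Selberg–Delange
  theorem for general coefficients `a_z = b_z * d_z`, by the printed reduction to Theorem 7.17
  (`MontgomeryVaughan2007_thm_7_18_of_thm_7_17`, `SelbergDelangeTheoremProofs.lean`, MV p. 179).

## The proof of Theorem 7.17 (MV pp. 177–178, in the Riesz-mean arrangement of Tenenbaum II.5 §5.4)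

The printed proof applies the truncated Perron formula to `ζ(s)^z = Σ d_z(n) n^{−s}` ((7.56)),
moves the contour into the classical zero-free region with a keyhole (Hankel loop) around the
branch point `s = 1`, and evaluates the loop by Hankel's formula for `1/Γ`. All of this is already
in the tree, organised around the absolutely convergent Perron formula of order one:

1. **The data** (`SelbergDelange.MeanValue717.rieszData_zetaPowCoeff`): with `G ≡ 1`, `a = d_z`,
   the hypotheses `SelbergDelange.RieszData R 0 2^R z d_z 1` of the contour engine hold —
   `Σ d_z(n) n^{−s} = ζ(s)^z` for `σ > 1` (`SelbergDelange.zetaPow_eq_LSeries`, (7.56)), absolute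
   convergence (`SelbergDelange.LSeriesSummable_zetaPowCoeff`), and the majorant
   "`|d_z(n)| ≤ d_R(n)`, `Σ d_R(n) n^{−σ} = ζ(σ)^R ≤ (σ/(σ−1))^R ≤ 2^R (σ−1)^{−R}`" (MV p. 178;
   `SelbergDelange.DivisorBounds.tsum_norm_zetaPowCoeff_div_rpow_le`).
2. **The contour argument** (`SelbergDelange.exists_riesz_expansion`, `SelbergDelangeRieszExpansion.lean`:
   Cauchy's theorem to the keyhole, `ζ(s)^z ≪ (log τ)^R` on the new path (MV Theorem 6.7),
   `ζ(s)^z/s = (s−1)^{−z}(1 + O(|s−1|))` near `1`, Hankel's formula): for the Riesz means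
   `A₁(y) = Σ_{n ≤ y} d_z(n)(y − n)` and `B₁(y) = Σ_{n ≤ y} d_R(n)(y − n)`,
   `A₁(y) = y² Σ_{k<N} c_k(z) Γ(z−k)⁻¹ (log y)^{z−1−k} + O_R(y² (log y)^{Re z−1−N})` (`y ≥ x₀(R)`)
   with `c₀ = G(1)/2 = 1/2` (`SelbergDelange.coeff_zero`), and the same for `B₁` with `z = R`.
3. **De-smoothing** (`SelbergDelangeOmega.norm_summatory_sub_le`, `SelbergDelangeOmegaProofs.lean`):
   `D_z(x) = (A₁(x+h) − A₁(x))/h + O(B(x+h) − B(x))` with `h = x (log x)^{−2R−1}`, the difference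
   quotient of the smooth expansion is `Γ(z)⁻¹ x (log x)^{z−1} + O(x (log x)^{Re z−2})`, and the
   short sum of the non-negative majorant `d_R` is controlled by the second difference of `B₁`
   (this replaces the short-interval divisor-sum estimate of the printed truncation step, p. 178).
4. Bounded `x` (`2 ≤ x ≤ X₁(R)`) are absorbed into the constant by the crude bound
   `|D_z(x)| ≤ Σ_{n ≤ x} d_R(n) ≤ x² Σ_n d_R(n) n^{−2} ≤ 2^R x²`
   (`SelbergDelange.MeanValue717.norm_sum_zetaPowCoeff_le`).

This is exactly the assembly used for `z^{Ω(n)}` in `MontgomeryVaughan2007_thm_7_18_Omega_holds`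
(`SelbergDelangeOmegaProofs.lean`), specialised to `G ≡ 1`; there is no restriction `R < 2` here
(in the `Ω` case it comes from the pole of `F(s,z)` where `2^s = z`; for `G ≡ 1` the data of the
engine hold for every `R ≥ 0`, the local factors of `d_z` being binomial series, entire in `z`).

## References

* [MontgomeryVaughan2007] H. L. Montgomery, R. C. Vaughan, *Multiplicative Number Theory I:
  Classical Theory*, Cambridge Stud. Adv. Math. 97, CUP 2007, §7.4, (7.56), Theorem 7.17 (p. 177) and
  its proof (pp. 177–178), Theorem 7.18 and its proof (pp. 178–179). doi:10.1017/CBO9780511618314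
* [Tenenbaum2015] G. Tenenbaum, *Introduction to analytic and probabilistic number theory*, 3rd
  ed., AMS GSM 163, II.5 §§5.3–5.4 (Theorem II.5.2).
* [Selberg1954] A. Selberg, *Note on a paper by L. G. Sathe*, J. Indian Math. Soc. 18 (1954) 83–87.
-/

noncomputable section

open Complex Set Filter Topology Metric Finset
open scoped Real Nat

namespace Literature.NumberTheory.LFunctions

namespace SelbergDelange

namespace MeanValue717

open SelbergDelangeOmega SelbergDelange.DivisorBounds

/-! ### The data of the engine for `d_z` (`G ≡ 1`) -/

/-- **`d_z` satisfies the hypotheses of the contour engine** with `G ≡ 1`, `σ₁ = 0`, `B = 2^R`: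
`Σ d_z(n) n^{−s} = ζ(s)^z` (`σ > 1`, (7.56)), absolute convergence, and the majorant
`Σ |d_z(n)| n^{−σ} ≤ Σ d_R(n) n^{−σ} = ζ(σ)^R ≤ (σ/(σ−1))^R ≤ 2^R/(σ−1)^R` for `1 < σ ≤ 2`
("`|d_z(n)| ≤ d_{|z|}(n) ≤ d_R(n)`", "`≪ ζ(a)^R`", MV p. 178).
[cite: MontgomeryVaughan2007, §7.4 (7.56) and p. 178] -/
theorem rieszData_zetaPowCoeff {R : ℝ} (hR : 0 ≤ R) {z : ℂ} (hz : ‖z‖ ≤ R) :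
    RieszData R 0 (2 ^ R) z (zetaPowCoeff z) (fun _ ↦ 1) := by
  have h2R : (1 : ℝ) ≤ 2 ^ R := Real.one_le_rpow one_le_two hR
  refine ⟨hz, differentiableOn_const _, fun s _ ↦ by simpa using h2R, fun σ hσ ↦ ?_,
    fun s hs ↦ ?_, fun σ hσ hσ2 ↦ ?_⟩
  · exact LSeriesSummable_zetaPowCoeff z (by simpa using hσ)
  · rw [mul_one, zetaPow_eq_LSeries z hs]
  · have hσ1 : 0 < σ - 1 := by linarith
    have hterm : ∀ n : ℕ, ‖LSeries.term (zetaPowCoeff z) (σ : ℂ) n‖ =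
        ‖zetaPowCoeff z n‖ / (n : ℝ) ^ σ := by
      intro n
      rcases eq_or_ne n 0 with rfl | hn
      · simp [LSeries.term_zero, Real.zero_rpow (by linarith : σ ≠ 0)]
      · rw [LSeries.term_of_ne_zero hn, norm_div,
          norm_natCast_cpow_of_pos (Nat.pos_of_ne_zero hn), ofReal_re]
    simp only [hterm]
    calc ∑' n : ℕ, ‖zetaPowCoeff z n‖ / (n : ℝ) ^ σ ≤ (σ / (σ - 1)) ^ R :=
          tsum_norm_zetaPowCoeff_div_rpow_le hz hσ
      _ = σ ^ R / (σ - 1) ^ R := Real.div_rpow (by linarith) hσ1.le R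
      _ ≤ 2 ^ R / (σ - 1) ^ R :=
          div_le_div_of_nonneg_right (Real.rpow_le_rpow (by linarith) hσ2 hR)
            (Real.rpow_nonneg hσ1.le R)

/-! ### The crude bound for bounded `x` -/

/-- **Crude bound for `D_z(x)`**: `|Σ_{n ≤ x} d_z(n)| ≤ Σ_{n ≤ x} d_R(n) ≤ x² Σ_n |d_z(n)| n^{−2}
≤ 2^R x²` for `‖z‖ ≤ R`, `x ≥ 1` (the majorant series at `σ = 2`). [folklore] -/
theorem norm_sum_zetaPowCoeff_le {z : ℂ} {R : ℝ} (hz : ‖z‖ ≤ R) {x : ℝ} (hx : 1 ≤ x) :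
    ‖∑ n ∈ Finset.Icc 1 ⌊x⌋₊, zetaPowCoeff z n‖ ≤ 2 ^ R * x ^ 2 := by
  have hx0 : 0 ≤ x := by linarith
  have hsum := summable_norm_zetaPowCoeff_div_rpow z (c := 2) one_lt_two
  have htsum : ∑' n : ℕ, ‖zetaPowCoeff z n‖ / (n : ℝ) ^ (2 : ℝ) ≤ 2 ^ R := by
    have h := tsum_norm_zetaPowCoeff_div_rpow_le hz (σ := 2) one_lt_two
    rwa [show ((2 : ℝ) / (2 - 1)) = 2 by norm_num] at h
  calc ‖∑ n ∈ Finset.Icc 1 ⌊x⌋₊, zetaPowCoeff z n‖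
      ≤ ∑ n ∈ Finset.Icc 1 ⌊x⌋₊, ‖zetaPowCoeff z n‖ := norm_sum_le _ _
    _ ≤ ∑ n ∈ Finset.Icc 1 ⌊x⌋₊, x ^ 2 * (‖zetaPowCoeff z n‖ / (n : ℝ) ^ (2 : ℝ)) := by
        refine Finset.sum_le_sum fun n hn ↦ ?_
        rw [Finset.mem_Icc] at hn
        have hn0 : (0 : ℝ) < n := by exact_mod_cast hn.1
        have hnx : (n : ℝ) ≤ x := (Nat.cast_le.2 hn.2).trans (Nat.floor_le hx0)
        rw [Real.rpow_two, mul_div_assoc', le_div_iff₀ (by positivity)]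
        have h0 : 0 ≤ ‖zetaPowCoeff z n‖ := norm_nonneg _
        have hsq : (n : ℝ) ^ 2 ≤ x ^ 2 := pow_le_pow_left₀ hn0.le hnx 2
        nlinarith
    _ = x ^ 2 * ∑ n ∈ Finset.Icc 1 ⌊x⌋₊, ‖zetaPowCoeff z n‖ / (n : ℝ) ^ (2 : ℝ) := by
        rw [Finset.mul_sum]
    _ ≤ x ^ 2 * ∑' n : ℕ, ‖zetaPowCoeff z n‖ / (n : ℝ) ^ (2 : ℝ) := by
        gcongr
        exact hsum.sum_le_tsum _ (fun n _ ↦ by positivity)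
    _ ≤ x ^ 2 * 2 ^ R := by gcongr
    _ = 2 ^ R * x ^ 2 := mul_comm _ _

/-- The lower bound `(log x)^e ≥ min((log 2)^R, (log X₁)^{−R−2})` for `2 ≤ x ≤ X₁`, `−R − 2 ≤ e ≤ R`
(used with `e = Re z − 2`). [folklore] -/
theorem rpow_log_ge_min {x X₁ R e : ℝ} (hx : 2 ≤ x) (hxX : x ≤ X₁) (hR : 0 ≤ R)
    (he : -R - 2 ≤ e) (he' : e ≤ R) :
    min (Real.log 2 ^ R) (Real.log X₁ ^ (-R - 2)) ≤ Real.log x ^ e := by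
  have hℓ0 : 0 < Real.log x := Real.log_pos (by linarith)
  have hl2 : 0 < Real.log 2 := Real.log_pos one_lt_two
  have hl21 : Real.log 2 ≤ 1 := by have := Real.log_two_lt_d9; linarith
  have hl2x : Real.log 2 ≤ Real.log x := Real.log_le_log two_pos hx
  have h2R1 : Real.log 2 ^ R ≤ 1 := Real.rpow_le_one hl2.le hl21 hR
  rcases le_or_gt (Real.log x) 1 with h1 | h1
  · rcases le_or_gt e 0 with he0 | he0
    · exact (min_le_left _ _).trans
        (h2R1.trans (Real.one_le_rpow_of_pos_of_le_one_of_nonpos hℓ0 h1 he0))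
    · refine (min_le_left _ _).trans ?_
      calc Real.log 2 ^ R ≤ Real.log 2 ^ e := Real.rpow_le_rpow_of_exponent_ge hl2 hl21 he'
        _ ≤ Real.log x ^ e := Real.rpow_le_rpow hl2.le hl2x he0.le
  · rcases le_or_gt 0 e with he0 | he0
    · exact (min_le_left _ _).trans (h2R1.trans (Real.one_le_rpow h1.le he0))
    · refine (min_le_right _ _).trans ?_
      have hX : Real.log x ≤ Real.log X₁ := Real.log_le_log (by linarith) hxX
      calc Real.log X₁ ^ (-R - 2) ≤ Real.log x ^ (-R - 2) :=
            Real.rpow_le_rpow_of_nonpos hℓ0 hX (by linarith)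
        _ ≤ Real.log x ^ e := Real.rpow_le_rpow_of_exponent_le h1.le he

end MeanValue717

end SelbergDelange

open SelbergDelange SelbergDelange.MeanValue717 SelbergDelangeOmega in
set_option maxHeartbeats 1600000 in
/-- **Montgomery–Vaughan, Theorem 7.17, PROVED** (discharge of
`Literature.NumberTheory.LFunctions.MontgomeryVaughan2007_thm_7_17`): for every `R > 0` there is
`C` with `|Σ_{1 ≤ n ≤ x} d_z(n) − Γ(z)⁻¹ x (log x)^{z−1}| ≤ C x (log x)^{Re z − 2}` for all real
`x ≥ 2` and all `|z| ≤ R`. Proof: the contour engine `SelbergDelange.exists_riesz_expansion` for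
the Riesz means of `d_z` and of the majorant `d_R` (`rieszData_zetaPowCoeff`: (7.56), Theorem 6.7
on the contour, the keyhole around `s = 1`, Hankel's formula), de-smoothing
(`SelbergDelangeOmega.norm_summatory_sub_le`), `2 c₀ = G(1) = 1` (`SelbergDelange.coeff_zero`), and
the crude bound `|D_z(x)| ≤ 2^R x²` for `2 ≤ x ≤ X₁`.
[cite: MontgomeryVaughan2007, §7.4 Theorem 7.17 (p. 177) and its proof (pp. 177–178)]
[cite: Tenenbaum2015, II.5 Theorem 5.2] -/
theorem MontgomeryVaughan2007_thm_7_17_holds : MontgomeryVaughan2007_thm_7_17 := by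
  intro R hRpos
  have hR0 : 0 ≤ R := hRpos.le
  -- the data and the engine
  set B : ℝ := 2 ^ R with hBdef
  have hB1 : 1 ≤ B := Real.one_le_rpow one_le_two hR0
  have hdata : ∀ z : ℂ, ‖z‖ ≤ R → RieszData R 0 B z (zetaPowCoeff z) (fun _ ↦ 1) :=
    fun z hz ↦ rieszData_zetaPowCoeff hR0 hz
  have hσ₁ : (0 : ℝ) < 1 := zero_lt_one
  set N : ℕ := 4 * ⌈R⌉₊ + 2 with hNdef
  have hRceil : R ≤ ⌈R⌉₊ := Nat.le_ceil R
  have hN : 4 * R + 2 ≤ (N : ℝ) := by rw [hNdef]; push_cast; linarith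
  have hN1 : 1 ≤ N := by omega
  have hRN : R ≤ (N : ℝ) := by linarith
  obtain ⟨C₁, x₀, hx₀, hexp⟩ := exists_riesz_expansion R 0 B hR0 hσ₁ N hRN
  -- uniform bounds for the coefficients
  obtain ⟨Cn, hCn0, hCn⟩ := exists_norm_exp_mul_logZeta₁_le R hR0
  obtain ⟨hρ, -, hρ4⟩ := rho_pos hσ₁
  obtain ⟨Γm, hΓm0, hΓm⟩ := exists_norm_inv_Gamma_le (R + N)
  set M : ℝ := Cn * B * 2 with hMdef
  set D : ℝ := M * (2 / rho 0) ^ N * Γm with hDdef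
  have hM0 : 0 ≤ M := by positivity
  have h2ρ : 1 ≤ 2 / rho 0 := by rw [le_div_iff₀ hρ]; linarith
  have hcoef : ∀ z : ℂ, ‖z‖ ≤ R → ∀ k < N,
      ‖coeff z (fun _ ↦ (1 : ℂ)) k * (Complex.Gamma (z - k))⁻¹‖ ≤ D := by
    intro z hz k hk
    have hd := hdata z hz
    have h1 := norm_coeff_le hρ (differentiableOn_smoothPart hd hσ₁)
      (fun s hs ↦ norm_smoothPart_le hd hσ₁ hCn hs) k
    have h2 : ‖(Complex.Gamma (z - k))⁻¹‖ ≤ Γm := hΓm _ (by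
      calc ‖z - (k : ℂ)‖ ≤ ‖z‖ + ‖(k : ℂ)‖ := norm_sub_le _ _
        _ ≤ R + N := by rw [Complex.norm_natCast]; exact add_le_add hz (by exact_mod_cast hk.le))
    rw [norm_mul, hDdef]
    refine mul_le_mul (h1.trans ?_) h2 (norm_nonneg _) (by positivity)
    exact mul_le_mul_of_nonneg_left (pow_le_pow_right₀ h2ρ hk.le) hM0
  -- the threshold and the constants
  set X₁ : ℝ := max (2 * x₀) (Real.exp 4) with hX₁def
  have hX₁2 : 2 ≤ X₁ := le_trans (by linarith) (le_max_left _ _)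
  set Cbig : ℝ := desmoothConst |C₁| D R N with hCbig
  set m : ℝ := min (Real.log 2 ^ R) (Real.log X₁ ^ (-R - 2)) with hmdef
  have hm0 : 0 < m := lt_min (Real.rpow_pos_of_pos (Real.log_pos one_lt_two) _)
    (Real.rpow_pos_of_pos (Real.log_pos (by linarith)) _)
  set Csmall : ℝ := B * X₁ / m + Γm * Real.log X₁ with hCsmall
  have hlogX₁ : 0 < Real.log X₁ := Real.log_pos (by linarith)
  have hCbig0 : 0 ≤ Cbig := by
    rw [hCbig, desmoothConst]
    have : 0 ≤ D := by positivity
    positivity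
  have hCsmall0 : 0 ≤ Csmall := by positivity
  refine ⟨Cbig + Csmall, fun x hx z hz ↦ ?_⟩
  have hx0 : 0 < x := by linarith
  have hzre : |z.re| ≤ R := (abs_re_le_norm z).trans hz
  -- the main term is `2 c₀ Γ(z)⁻¹ x (log x)^{z-1}`, `c₀ = G(1)/2 = 1/2`
  have hmainterm : (Complex.Gamma z)⁻¹ * (x : ℂ) * ((Real.log x : ℝ) : ℂ) ^ (z - 1) =
      2 * (coeff z (fun _ ↦ (1 : ℂ)) 0 * (Complex.Gamma (z - (0 : ℕ)))⁻¹) * x *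
        clog x ^ (z - 1) := by
    rw [coeff_zero, clog, Nat.cast_zero, sub_zero]; ring
  have hsumeq : ∑ n ∈ Finset.Icc 1 ⌊x⌋₊, zetaPowCoeff z n = summatory (zetaPowCoeff z) x := by
    rw [summatory, Icc_one_eq_Ioc_zero]
  rcases le_or_gt X₁ x with hxX | hxX
  · -- large `x`: de-smoothing
    have hmain := norm_summatory_sub_le (a := zetaPowCoeff z) (b := fun n ↦ ‖zetaPowCoeff (R : ℂ) n‖)
      (fun n ↦ norm_zetaPowCoeff_le hz n) (fun n ↦ norm_nonneg _) hz hN1 hN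
      (c := fun k ↦ coeff z (fun _ ↦ (1 : ℂ)) k * (Complex.Gamma (z - k))⁻¹)
      (cR := fun k ↦ coeff (R : ℂ) (fun _ ↦ (1 : ℂ)) k * (Complex.Gamma (R - k))⁻¹)
      (D := D) (hcoef z hz) (hcoef R (by rw [Complex.norm_real, Real.norm_of_nonneg hR0]))
      (C₁ := |C₁|) (x₀ := x₀) hx₀ (abs_nonneg C₁) ?_ ?_ (x := x)
      ((le_max_left _ _).trans hxX) ((le_max_right _ _).trans hxX)
    · rw [hsumeq, hmainterm]
      refine hmain.trans ?_
      have : 0 ≤ x * Real.log x ^ (z.re - 2) := by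
        have := Real.rpow_nonneg (Real.log_nonneg (by linarith : (1:ℝ) ≤ x)) (z.re - 2)
        positivity
      nlinarith
    · intro y hy
      have h1 := hexp z (zetaPowCoeff z) (fun _ ↦ (1 : ℂ)) (hdata z hz) y hy
      rw [expansion_eq] at h1
      refine (le_of_eq (by rfl)).trans (h1.trans ?_)
      have : 0 ≤ y ^ 2 * Real.log y ^ (z.re - 1 - N) := by
        have := Real.rpow_nonneg (Real.log_nonneg (by linarith : (1:ℝ) ≤ y)) (z.re - 1 - N)
        positivity
      nlinarith [le_abs_self C₁]
    · intro y hy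
      have hRnorm : ‖(R : ℂ)‖ ≤ R := by rw [Complex.norm_real, Real.norm_of_nonneg hR0]
      have h1 := hexp R (zetaPowCoeff R) (fun _ ↦ (1 : ℂ)) (hdata R hRnorm) y hy
      rw [expansion_eq] at h1
      have hcoe : rieszMeanC (fun n ↦ ((‖zetaPowCoeff (R : ℂ) n‖ : ℝ) : ℂ)) y =
          rieszMeanC (zetaPowCoeff R) y := by
        simp only [rieszMeanC, ← zetaPowCoeff_ofReal_eq_norm hR0]
      rw [hcoe]
      refine (le_of_eq (by rfl)).trans (h1.trans ?_)
      simp only [ofReal_re]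
      have : 0 ≤ y ^ 2 * Real.log y ^ (R - 1 - N) := by
        have := Real.rpow_nonneg (Real.log_nonneg (by linarith : (1:ℝ) ≤ y)) (R - 1 - N)
        positivity
      nlinarith [le_abs_self C₁]
  · -- bounded `x`: crude bounds
    have hA := norm_sum_zetaPowCoeff_le hz (show (1 : ℝ) ≤ x by linarith)
    have hΓ : ‖(Complex.Gamma z)⁻¹‖ ≤ Γm := hΓm z (hz.trans (by linarith))
    have hℓ0 : 0 < Real.log x := Real.log_pos (by linarith)
    have hℓX : Real.log x ≤ Real.log X₁ := Real.log_le_log hx0 hxX.le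
    have hpow : min (Real.log 2 ^ R) (Real.log X₁ ^ (-R - 2)) ≤ Real.log x ^ (z.re - 2) :=
      MeanValue717.rpow_log_ge_min hx hxX.le hR0 (by linarith [(abs_le.1 hzre).1])
        (by linarith [(abs_le.1 hzre).2])
    rw [← hmdef] at hpow
    have hmain : ‖(Complex.Gamma z)⁻¹ * (x : ℂ) * ((Real.log x : ℝ) : ℂ) ^ (z - 1)‖ ≤
        Γm * Real.log X₁ * (x * Real.log x ^ (z.re - 2)) := by
      rw [norm_mul, norm_mul, Complex.norm_real, Real.norm_of_nonneg hx0.le,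
        norm_cpow_eq_rpow_re_of_pos hℓ0, sub_re, one_re]
      have hsplit : Real.log x ^ (z.re - 1) = Real.log x ^ (z.re - 2) * Real.log x := by
        rw [show z.re - 1 = (z.re - 2) + 1 by ring, Real.rpow_add hℓ0, Real.rpow_one]
      rw [hsplit]
      have hpow0 : 0 ≤ Real.log x ^ (z.re - 2) := (Real.rpow_pos_of_pos hℓ0 _).le
      calc ‖(Complex.Gamma z)⁻¹‖ * x * (Real.log x ^ (z.re - 2) * Real.log x)
          ≤ Γm * x * (Real.log x ^ (z.re - 2) * Real.log X₁) := by gcongr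
        _ = _ := by ring
    have hsum : ‖∑ n ∈ Finset.Icc 1 ⌊x⌋₊, zetaPowCoeff z n‖ ≤
        B * X₁ / m * (x * Real.log x ^ (z.re - 2)) := by
      have h2 : B * x ^ 2 ≤ B * X₁ * x := by
        have : x ^ 2 ≤ X₁ * x := by nlinarith
        calc B * x ^ 2 ≤ B * (X₁ * x) := mul_le_mul_of_nonneg_left this (by positivity)
          _ = B * X₁ * x := by ring
      have h3 : B * X₁ * x = B * X₁ / m * (x * m) := by field_simp
      calc _ ≤ B * X₁ * x := hA.trans h2
        _ = B * X₁ / m * (x * m) := h3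
        _ ≤ B * X₁ / m * (x * Real.log x ^ (z.re - 2)) := by
            refine mul_le_mul_of_nonneg_left (mul_le_mul_of_nonneg_left hpow hx0.le) (by positivity)
    calc ‖(∑ n ∈ Finset.Icc 1 ⌊x⌋₊, zetaPowCoeff z n) -
          (Complex.Gamma z)⁻¹ * (x : ℂ) * ((Real.log x : ℝ) : ℂ) ^ (z - 1)‖
        ≤ ‖∑ n ∈ Finset.Icc 1 ⌊x⌋₊, zetaPowCoeff z n‖ +
          ‖(Complex.Gamma z)⁻¹ * (x : ℂ) * ((Real.log x : ℝ) : ℂ) ^ (z - 1)‖ := norm_sub_le _ _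
      _ ≤ B * X₁ / m * (x * Real.log x ^ (z.re - 2)) +
          Γm * Real.log X₁ * (x * Real.log x ^ (z.re - 2)) := add_le_add hsum hmain
      _ = Csmall * x * Real.log x ^ (z.re - 2) := by rw [hCsmall]; ring
      _ ≤ (Cbig + Csmall) * x * Real.log x ^ (z.re - 2) := by
          have : 0 ≤ x * Real.log x ^ (z.re - 2) := by positivity
          nlinarith

/-- **Montgomery–Vaughan, Theorem 7.18 (the Selberg–Delange theorem, general coefficients
`a_z = b_z * d_z`), PROVED** (discharge of
`Literature.NumberTheory.LFunctions.MontgomeryVaughan2007_thm_7_18`): Theorem 7.17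
(`MontgomeryVaughan2007_thm_7_17_holds`) fed into the printed reduction
`MontgomeryVaughan2007_thm_7_18_of_thm_7_17` (`SelbergDelangeTheoremProofs.lean`, MV p. 179:
`A_z(x) = Σ_{m ≤ x} b_z(m) D_z(x/m)`, Theorem 7.17 at `x/m` for `m ≤ x/2`,
`(log x/m)^{z−1} = (log x)^{z−1}(1 + O(log m/log x))` for `m ≤ √x`, and the hypothesis
`Σ |b_z(m)|(log m)^{2R+1}/m ≪ 1` for the tails).
[cite: MontgomeryVaughan2007, §7.4 Theorem 7.18 (pp. 178–179)] -/
theorem MontgomeryVaughan2007_thm_7_18_holds : MontgomeryVaughan2007_thm_7_18 :=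
  MontgomeryVaughan2007_thm_7_18_of_thm_7_17 MontgomeryVaughan2007_thm_7_17_holds

end Literature.NumberTheory.LFunctions
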